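import Summits.CriticalPhenomena.PercolationContinuityZ3.Theorems.PercNearOneGluingNoHeavyLowerTailSahiThreeCopyPairs
import Summits.CriticalPhenomena.PercolationContinuityZ3.Theorems.PercNearOneGluingNoHeavyLowerTailSahiThreeCopyPairSubst

/-!
# `NoHeavyLowerTail` (crux stmt-CriticalPhenomena-4575), Sahi programme: **THE GENERATED CLASS OF UNIVERSALLY GOOD PAIRS** —
# 3C-SAHI (hence Kahn's inequality, third event ARBITRARY) for every pair in the closure of {pairs on ≤ 4 coordinates, nested pairs,
# pairs with a cumulation member, block-independent pairs} under blockwise monotone substitution, lifting, renaming and swapping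

Support file (Sahi cell, seat `prim-sahi-p1`, generation 55; `--supports stmt-CriticalPhenomena-4575`).  COMPUTATIONAL only through the
base case `UGen.base` (`uGood_of_le_four`, `…CubeFour`).  Capstone of the generation-55 structure theorems:
* `UGood.subst` — `…PairSubst.tc_subst_free_nonneg` in the vocabulary of `…Pairs`: universally good pairs are closed under
  substituting the first variable by a monotone Boolean function of a fresh block (third slot free);
* `UGen` — the inductive class generated from the settled bases by the settled operations, and ★★ `UGen.uGood`: EVERY PAIR IN THE
  CLASS IS UNIVERSALLY GOOD, i.e. `c_b(f,g,H) ≥ 0` for every profile and every nonnegative monotone `H`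
  (`UGen.tc_nonneg`, law level `UGen.sahiE_three_coin_nonneg`).
In words: let `σ₁,…,σ₄` be ANY increasing Boolean functions of pairwise disjoint blocks of variables (any sizes) and `Φ_A, Φ_B` ANY
two monotone Boolean functions of four arguments; then for `A = Φ_A(σ₁,…,σ₄)`, `B = Φ_B(σ₁,…,σ₄)` and EVERY increasing `C` (on any
number of further variables as well), Sahi's `E₃(1_A,1_B,1_C)` is Bernstein-positive, in particular `≥ 0` under every product measure
(Kahn's Conjecture 5 for this class) — and the same for nested `A ⊆ B`, for `A` a cylinder, for block-independent `A, B`, and for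
everything obtained from these by further substitutions.  Nothing conjectural is used.  [this work]
-/

namespace Summit.CriticalPhenomena.PercolationContinuityZ3.Theorems.SahiThreeCopy

open Finset Function Literature.Combinatorics.Sahi2008
open scoped BigOperators

noncomputable section

variable {n d : ℕ}

/-- ★★ **Universally good pairs are closed under blockwise monotone substitution** (third slot free). [this work] -/
theorem UGood.subst {f g : Pt (d + 1) → ℝ} (h : UGood f g) (e : ℕ) {σ : Pt e → Bool} (hσ : Monotone σ) :
    UGood (subst e σ f) (subst e σ g) :=
  ⟨subst_nonneg e σ h.1, subst_nonneg e σ h.2.1, subst_monotone e hσ h.2.2.1, subst_monotone e hσ h.2.2.2.1,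
    fun B _ hH hHm => tc_subst_free_nonneg e hσ (fun b' H' hH' hH'm => h.2.2.2.2 b' H' hH' hH'm) hH hHm B⟩

/-- **The generated class of pairs**: bases = pairs on `≤ 4` coordinates, nested pairs (`f·g = f`, `g ≤ 1`), pairs with a cumulation
(coordinate-product) member, block-independent pairs; operations = swap, lift to more coordinates, rename coordinates, substitute the
first variable by a monotone block function. [this work] -/
inductive UGen : (n : ℕ) → (Pt n → ℝ) → (Pt n → ℝ) → Prop
  | base {d : ℕ} (hd : d ≤ 4) {f g : Pt d → ℝ} (hf : ∀ x, 0 ≤ f x) (hfm : Monotone f) (hg : ∀ x, 0 ≤ g x) (hgm : Monotone g) :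
      UGen d f g
  | nested {n : ℕ} {f g : Pt n → ℝ} (hf : ∀ x, 0 ≤ f x) (hfm : Monotone f) (hg : ∀ x, 0 ≤ g x) (hgm : Monotone g)
      (hfg : f * g = f) (hg1 : ∀ x, g x ≤ 1) : UGen n f g
  | cprod {n : ℕ} {α β : Fin n → ℝ} (hα : ∀ i, 0 ≤ α i) (hβ : ∀ i, 0 ≤ β i) {g : Pt n → ℝ} (hg : ∀ x, 0 ≤ g x)
      (hgm : Monotone g) : UGen n (cprod α β) g
  | indep {n : ℕ} {f g : Pt n → ℝ} {T : Finset (Fin n)} (hfT : DependsOn f T) (hgT : DependsOn g (univ \ T))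
      (hf : ∀ x, 0 ≤ f x) (hfm : Monotone f) (hg : ∀ x, 0 ≤ g x) (hgm : Monotone g) : UGen n f g
  | symm {n : ℕ} {f g : Pt n → ℝ} (h : UGen n f g) : UGen n g f
  | lift {d : ℕ} {f g : Pt d → ℝ} (h : UGen d f g) (m : ℕ) : UGen (d + m) (liftB m f) (liftB m g)
  | rename {n : ℕ} {f g : Pt n → ℝ} (h : UGen n f g) (τ : Fin n ≃ Fin n) :
      UGen n (fun x => f (rePt τ x)) (fun x => g (rePt τ x))
  | subst {d : ℕ} {f g : Pt (d + 1) → ℝ} (h : UGen (d + 1) f g) (e : ℕ) {σ : Pt e → Bool} (hσ : Monotone σ) :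
      UGen (d + e) (SahiThreeCopy.subst e σ f) (SahiThreeCopy.subst e σ g)

/-- ★★ **Every pair in the generated class is universally good.** [this work] -/
theorem UGen.uGood {n : ℕ} {f g : Pt n → ℝ} (h : UGen n f g) : UGood f g := by
  induction h with
  | base hd hf hfm hg hgm => exact uGood_of_le_four hd hf hfm hg hgm
  | nested hf hfm hg hgm hfg hg1 => exact uGood_of_mul_eq hf hfm hg hgm hfg hg1
  | cprod hα hβ hg hgm => exact uGood_cprod hα hβ hg hgm
  | indep hfT hgT hf hfm hg hgm => exact uGood_of_dependsOn hfT hgT hf hfm hg hgm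
  | symm _ ih => exact ih.symm
  | lift _ m ih => exact ih.liftB m
  | rename _ τ ih => exact ih.rePt τ
  | subst _ e hσ ih => exact ih.subst e hσ

/-- The coefficient statement: for `(f,g)` in the generated class and EVERY nonnegative monotone `H`, `0 ≤ c_b(f,g,H)` at every
profile. [this work] -/
theorem UGen.tc_nonneg {n : ℕ} {f g : Pt n → ℝ} (h : UGen n f g) {H : Pt n → ℝ} (hH : ∀ x, 0 ≤ H x) (hHm : Monotone H)
    (b : Fin n → ℕ) : 0 ≤ tc b f g H :=
  h.uGood.2.2.2.2 b H hH hHm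

/-- **Law level (Kahn's Conjecture 5 for the generated class)**: `E₃^{coin q}(f,g,H) ≥ 0` under every product measure. [this work] -/
theorem UGen.sahiE_three_coin_nonneg {n : ℕ} {f g : Pt n → ℝ} (h : UGen n f g) {q : Fin n → ℝ}
    (hq : ∀ i, 0 ≤ q i ∧ q i ≤ 1) {H : Pt n → ℝ} (hH : ∀ x, 0 ≤ H x) (hHm : Monotone H) :
    0 ≤ sahiE (coinWeight q) 3 ![f, g, H] :=
  sahiE_three_coin_nonneg_of_tc hq fun b => h.tc_nonneg hH hHm b

/-- Example of the shape covered (one substitution step spelled out): for `d + 1 ≤ 4`, nonnegative monotone `f, g` on `{0,1}^{d+1}`,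
a monotone block function `σ` on `e` fresh variables and ANY nonnegative monotone `H` on `{0,1}^{d+e}`:
`0 ≤ c_B(subst σ f, subst σ g, H)`. [this work] -/
theorem tc_subst_free_nonneg_of_le_four (hd : d + 1 ≤ 4) (e : ℕ) {σ : Pt e → Bool} (hσ : Monotone σ) {f g : Pt (d + 1) → ℝ}
    (hf : ∀ x, 0 ≤ f x) (hfm : Monotone f) (hg : ∀ x, 0 ≤ g x) (hgm : Monotone g) {H : Pt (d + e) → ℝ} (hH : ∀ w, 0 ≤ H w)
    (hHm : Monotone H) (B : Fin (d + e) → ℕ) : 0 ≤ tc B (subst e σ f) (subst e σ g) H :=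
  ((UGen.base hd hf hfm hg hgm).subst e hσ).tc_nonneg hH hHm B

end

end Summit.CriticalPhenomena.PercolationContinuityZ3.Theorems.SahiThreeCopy
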